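import Literature.MathematicalPhysics.QuantumLattice.InfVolFermionStateTorusLimitTwoSectorSingleAnnihilator
import Literature.MathematicalPhysics.QuantumLattice.InfVolFermionStateTorusLimitTwoSectorSingleCreator
import Literature.MathematicalPhysics.QuantumLattice.InfVolFermionStateSpinSectorDensity
import Literature.MathematicalPhysics.QuantumLattice.HubbardEnergyDensityVariationalPrinciple
import HarnessLib

/-!
# The two-sector rows of the thermal object of record: exact one-site densities for the `x`/`y'` moments
# of the single-site generator, and the REVERSED row (raising generator read from the companion)

Topic `Literature/MathematicalPhysics/QuantumLattice`; complement of
`InfVolFermionStateTorusLimitTwoSectorSingleAnnihilator.lean` (the «rm↑» two-sector energy–entropy balance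
row `0 ≤ β·Re ω(c̃†[H_{Λ₁}, c̃]) − s·Re ω(c̃†c̃) + q·r·Re ω'(c̃c̃†)` for a thermal torus limit `ω` of the
canonical `(rectN n L, S^z = 0)` Gibbs states, a companion torus limit `ω'` of the canonical states of the
image sectors `(k_L − 1, k_L)`, and `r = lim Z_{(k−1,k)}/Z_{(k,k)}`), of `…SingleCreator.lean` (abstract
brackets from linear rows) and of `InfVolFermionStateSpinSectorDensity.lean` (density rows of the companion).
Three additions, all PROVED (no definition, no named fact):

* §1 bookkeeping for `k_L = halfRectN n L`: `k_L ≥ 1` eventually, `k_L ≤ L²`, and the density limits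
  `k_{L_j}/L_j² → n/2`, `(k_{L_j} − 1)/L_j² → n/2` along `Ls → ∞`;
* §2 the `x`- and `y'`-MOMENTS of the single-site generator ARE one-site densities: for translation-invariant
  `ω`, `ω_{Λ'}(c̃†c̃) = ω(n_{0σ})` and `ω_{Λ'}(c̃c̃†) = 1 − ω(n_{0σ})` (`c̃ = Γ_{Λ⊆Λ'}c_{xσ}`, CAR + compatibility +
  translation invariance); by name for the object of record (`Re ω(n_{0σ}) = n/2`,
  `IsTorusLimitOfMixture.re_expect_nAt_eq_half_of_sectorGibbs`) and for the companion `(k_L − 1, k_L)`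
  (`Re ω'(n_{0↑}) = n/2`, `…re_expect_nAt_up_eq_half_of_predCompanion`);
* §3 the REVERSED row (`IsTorusLimitOfMixture.re_expect_twoSector_eeb_creation_up_reverse_nonneg_of_sectorGibbs`):
  the raising generator `c†_{x↑}` carries the companion sector `(k − 1, k)` back into `(k, k)`, so for the same
  pair `(ω, ω')` and the INVERTED ratio `r' = lim Z_{(k,k)}/Z_{(k−1,k)}`:
  `0 ≤ β·Re ω'_{Λ₁}(c̃(H_{Λ₁}c̃† − c̃†H_{Λ₁})) − s·Re ω'_{Λ₁}(c̃c̃†) + q·r'·Re ω_{Λ₁}(c̃†c̃)` — the row that links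
  the companion's moments BACK to the object of record with one shared parameter (the two-way linking of the
  relaxation recipe), obtained from the general pair theorem
  `InfVolFermionState.re_expect_twoSector_eeb_nonneg_of_canonical_limits_eventually` with the roles of the
  two sectors exchanged.

HONEST SCOPE: rows for PAIRS of states along a common side sequence; no claim `ω' = ω`, no equivalence of
ensembles, no number. The existence of the joint data without a bracket hypothesis and the a-priori bracket
on `log r` are the business of the companion files `…TwoSectorCompanionExistence.lean` /
`…TwoSectorRatioBracket.lean`.

## Mathlib / tree search

REUSED: `InfVolFermionState.re_expect_twoSector_eeb_nonneg_of_canonical_limits_eventually`,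
`annihilation_up_mulVec_mem_szSector_pred`, `creation_up_mulVec_mem_szSector_rectN`,
`fermionEmbed_toTorusEmb_incl_creation` (`…SingleAnnihilator`, `…SingleCreator`);
`IsTorusLimitOfMixture.expect_nAt_eq_of_szSector'`, `…re_expect_nAt_eq_of_spinSectorGibbs`
(`InfVolFermionStateSpinSectorDensity`); `IsTranslationInvariant.expect_nAt`
(`HubbardEnergyDensityVariationalPrinciple`); `IsTorusLimitOfMixture.isTranslationInvariant`
(`TorusLimitOfMixtures`); `annihilation_mul_creation` (CAR), `fermionEmbed_conjTranspose_mul_self`,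
`InfVolFermionState.compatible`, `expect_one`; `exists_spinConfig_of_le`, `exists_szConfig`,
`sum_sectorGibbsWeightTT'`, `sectorGibbsVectorTT'_mem_szSector`. `lean search 'reverse_nonneg|predCompanion'`:
nothing (2026-08-27).

## References

* O. Bratteli, D. W. Robinson, *Operator Algebras and Quantum Statistical Mechanics 2* (1997), Thm. 5.3.15
  (Araki–Sewell), §5.4.2 (chemical potential of gauge-invariant KMS states). [cite: BratteliRobinsonII1997, §5.4.2]
* H. Fawzi, O. Fawzi, S. O. Scalet (2024), Thm. 3.1 (linearised EEB rows). [cite: FawziFawziScalet2024, Thm. 3.1]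
* H. Araki, H. Moriya, Rev. Math. Phys. 15 (2003) 93, §4.1 (local CAR algebras, translation-invariant
  states). [cite: ArakiMoriya2003, §4.1 Def. 4.5]
* D. Ruelle, *Statistical Mechanics: Rigorous Results* (1969), §3.4 (densities of limit states).
  [cite: Ruelle1969, §3.4]
* E. H. Lieb, Phys. Rev. Lett. 62 (1989) 1201, eq. (2) (`c_{xσ}` between spin sectors).
  [cite: LiebPRL1989, proof of Theorem 1]
* J. P. F. LeBlanc et al. (Simons Collaboration), Phys. Rev. X 5 (2015) 041041, eq. (1) (fixed-density
  sectors `N = ⌊nL²⌋`). [cite: LeBlancEtAl2015, eq. (1)]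
* R. B. Israel, *Convexity in the Theory of Lattice Gases* (1979), §I.3 eq. (26) (canonical Gibbs weights).
  [cite: Israel1979, §I.3 eq. (26)]
-/

noncomputable section

namespace Literature.MathematicalPhysics.QuantumLattice

open Matrix Finset HubbardWave0 Literature.Probability.LatticeModels ThermodynamicLimit
open _root_.Filter
open scoped _root_.Topology ComplexOrder BigOperators

/-! ### §1 Bookkeeping: `k_L = halfRectN n L`, its density limit, and the one-site densities read through
the embedded generator -/

section Bookkeeping

/-- `k_L = halfRectN n L ≥ 1` as soon as `n·L ≥ 2` (`0 < n`, `1 ≤ L`; sector bookkeeping of fixed-density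
cluster families). [cite: LeBlancEtAl2015, eq. (1)] -/
theorem one_le_halfRectN_of_two_le {n : ℝ} (hn : 0 < n) {L : ℕ} (hL1 : 1 ≤ L) (hL : 2 ≤ n * L) :
    1 ≤ halfRectN n L := by
  unfold halfRectN
  rw [Nat.le_floor_iff (by positivity)]
  have hL' : (1 : ℝ) ≤ L := by exact_mod_cast hL1
  have : n * L ≤ n * (L : ℝ) ^ 2 := by
    rw [sq]
    exact mul_le_mul_of_nonneg_left (le_mul_of_one_le_right (by positivity) hL') hn.le
  push_cast
  linarith

/-- Along `Ls → ∞`, eventually `1 ≤ halfRectN n (Ls j)` (`0 < n`). [cite: LeBlancEtAl2015, eq. (1)] -/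
theorem eventually_one_le_halfRectN_comp {n : ℝ} (hn : 0 < n) {Ls : ℕ → ℕ}
    (hLs : Tendsto Ls atTop atTop) : ∀ᶠ j in atTop, 1 ≤ halfRectN n (Ls j) := by
  filter_upwards [hLs.eventually_ge_atTop (⌈2 / n⌉₊ + 1)] with j hj
  refine one_le_halfRectN_of_two_le hn (by omega) ?_
  have h1 : (⌈2 / n⌉₊ : ℝ) + 1 ≤ Ls j := by exact_mod_cast hj
  have h2 : 2 / n ≤ ⌈2 / n⌉₊ := Nat.le_ceil _
  have h3 : 2 / n ≤ (Ls j : ℝ) := by linarith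
  have := mul_le_mul_of_nonneg_left h3 hn.le
  rwa [mul_div_cancel₀ _ hn.ne'] at this

/-- `halfRectN n L ≤ n L²/2` (`0 ≤ n`). [cite: LeBlancEtAl2015, eq. (1)] -/
theorem halfRectN_le_half_mul_sq {n : ℝ} (hn0 : 0 ≤ n) (L : ℕ) :
    (halfRectN n L : ℝ) ≤ n / 2 * (L : ℝ) ^ 2 := by
  unfold halfRectN
  have h := Nat.floor_le (a := n * (L : ℝ) ^ 2 / 2) (by positivity)
  linarith

/-- `n L²/2 − 1 < halfRectN n L` (`0 ≤ n`). [cite: LeBlancEtAl2015, eq. (1)] -/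
theorem half_mul_sq_sub_one_lt_halfRectN (n : ℝ) (L : ℕ) :
    n / 2 * (L : ℝ) ^ 2 - 1 < (halfRectN n L : ℝ) := by
  unfold halfRectN
  have := Nat.lt_floor_add_one (n * (L : ℝ) ^ 2 / 2)
  linarith

/-- `halfRectN n L ≤ L·L` for `0 ≤ n ≤ 2` (at most one electron per orbital). [cite: LeBlancEtAl2015, eq. (1)] -/
theorem halfRectN_le_mul_self {n : ℝ} (hn0 : 0 ≤ n) (hn2 : n ≤ 2) (L : ℕ) : halfRectN n L ≤ L * L := by
  have h := halfRectN_le_half_mul_sq hn0 L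
  have h2 : n / 2 * (L : ℝ) ^ 2 ≤ (L : ℝ) * L := by
    rw [sq]; nlinarith [mul_self_nonneg (L : ℝ)]
  exact_mod_cast h.trans h2

/-- **`k_{L_j}/L_j² → n/2`** along `Ls → ∞` (`0 ≤ n`). [cite: LeBlancEtAl2015, eq. (1)] -/
theorem tendsto_halfRectN_div_sq_comp {n : ℝ} (hn0 : 0 ≤ n) {Ls : ℕ → ℕ} (hLs : Tendsto Ls atTop atTop) :
    Tendsto (fun j => (halfRectN n (Ls j) : ℝ) / (Ls j : ℝ) ^ 2) atTop (𝓝 (n / 2)) := by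
  have hL : Tendsto (fun j => ((Ls j : ℕ) : ℝ)) atTop atTop := tendsto_natCast_atTop_atTop.comp hLs
  have hsq : Tendsto (fun j => ((Ls j : ℝ) ^ 2)⁻¹) atTop (𝓝 0) :=
    (tendsto_pow_atTop two_ne_zero |>.comp hL).inv_tendsto_atTop
  -- squeeze between `n/2 − 1/L²` and `n/2`
  have hlo : Tendsto (fun j => n / 2 - ((Ls j : ℝ) ^ 2)⁻¹) atTop (𝓝 (n / 2)) := by
    simpa using (tendsto_const_nhds (x := n / 2)).sub hsq
  refine tendsto_of_tendsto_of_tendsto_of_le_of_le' hlo tendsto_const_nhds ?_ ?_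
  · filter_upwards [hLs.eventually_ge_atTop 1] with j hj
    have hL0 : (0 : ℝ) < (Ls j : ℝ) ^ 2 := by positivity
    have hb := half_mul_sq_sub_one_lt_halfRectN n (Ls j)
    rw [sub_le_iff_le_add, div_add' _ _ _ hL0.ne', le_div_iff₀ hL0, inv_mul_cancel₀ hL0.ne']
    linarith
  · filter_upwards [hLs.eventually_ge_atTop 1] with j hj
    have hL0 : (0 : ℝ) < (Ls j : ℝ) ^ 2 := by positivity
    have hb := halfRectN_le_half_mul_sq hn0 (Ls j)
    rw [div_le_iff₀ hL0]
    linarith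

/-- **`(k_{L_j} − 1)/L_j² → n/2`** as well. [cite: LeBlancEtAl2015, eq. (1)] -/
theorem tendsto_halfRectN_pred_div_sq_comp {n : ℝ} (hn0 : 0 ≤ n) {Ls : ℕ → ℕ} (hLs : Tendsto Ls atTop atTop) :
    Tendsto (fun j => ((halfRectN n (Ls j) - 1 : ℕ) : ℝ) / (Ls j : ℝ) ^ 2) atTop (𝓝 (n / 2)) := by
  have hL : Tendsto (fun j => ((Ls j : ℕ) : ℝ)) atTop atTop := tendsto_natCast_atTop_atTop.comp hLs
  have hsq : Tendsto (fun j => ((Ls j : ℝ) ^ 2)⁻¹) atTop (𝓝 0) :=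
    (tendsto_pow_atTop two_ne_zero |>.comp hL).inv_tendsto_atTop
  have hlo : Tendsto (fun j => (halfRectN n (Ls j) : ℝ) / (Ls j : ℝ) ^ 2 - ((Ls j : ℝ) ^ 2)⁻¹) atTop
      (𝓝 (n / 2)) := by
    simpa using (tendsto_halfRectN_div_sq_comp hn0 hLs).sub hsq
  refine tendsto_of_tendsto_of_tendsto_of_le_of_le' hlo (tendsto_halfRectN_div_sq_comp hn0 hLs) ?_ ?_
  · filter_upwards [hLs.eventually_ge_atTop 1] with j hj
    have hL0 : (0 : ℝ) < (Ls j : ℝ) ^ 2 := by positivity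
    have hk : (halfRectN n (Ls j) : ℝ) - 1 ≤ ((halfRectN n (Ls j) - 1 : ℕ) : ℝ) := by
      rw [sub_le_iff_le_add]
      exact_mod_cast (le_tsub_add : halfRectN n (Ls j) ≤ halfRectN n (Ls j) - 1 + 1)
    rw [inv_eq_one_div, div_sub_div_same]
    exact div_le_div_of_nonneg_right hk hL0.le
  · filter_upwards with j
    have hL0 : (0 : ℝ) ≤ (Ls j : ℝ) ^ 2 := by positivity
    exact div_le_div_of_nonneg_right (by exact_mod_cast Nat.sub_le _ _) hL0

end Bookkeeping

/-! ### §2 The `x`- and `y'`-moments of the single-site generator are one-site densities -/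

section Densities

variable {d : ℕ}

/-- `c̃†c̃ = Γ(n_{xσ})` for the generator `c̃ = Γ_{Λ⊆Λ'}c_{xσ}` embedded in a larger region.
[cite: ArakiMoriya2003, §4.1 Def. 4.3] -/
theorem conjTranspose_mul_fermionEmbed_incl_cAt {Λ Λ' : Finset (Site d)} (h : Λ ⊆ Λ') {x : Site d}
    (hx : x ∈ Λ) (σ : Fin 2) :
    (fermionEmbed (PolySite.incl h) (annihilation (orb (PolySite.pt x hx) σ)))ᴴ *
        fermionEmbed (PolySite.incl h) (annihilation (orb (PolySite.pt x hx) σ)) =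
      fermionEmbed (PolySite.incl h) (nAt x hx σ) := by
  rw [← fermionEmbed_conjTranspose_mul_self, annihilation_conjTranspose]
  rfl

/-- `c̃c̃† = 1 − Γ(n_{xσ})` (CAR). [cite: ArakiMoriya2003, §4.1 Def. 4.3] -/
theorem fermionEmbed_incl_cAt_mul_conjTranspose {Λ Λ' : Finset (Site d)} (h : Λ ⊆ Λ') {x : Site d}
    (hx : x ∈ Λ) (σ : Fin 2) :
    fermionEmbed (PolySite.incl h) (annihilation (orb (PolySite.pt x hx) σ)) *
        (fermionEmbed (PolySite.incl h) (annihilation (orb (PolySite.pt x hx) σ)))ᴴ =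
      1 - fermionEmbed (PolySite.incl h) (nAt x hx σ) := by
  rw [← fermionEmbed_conjTranspose, ← fermionEmbed_mul, annihilation_conjTranspose, annihilation_mul_creation,
    if_pos rfl, fermionEmbed_sub, fermionEmbed_one]
  rfl

namespace InfVolFermionState

/-- `ω_Λ(n_{xσ}) = ω_{{x}}(n_{xσ})` (compatibility along `𝔄_{{x}} ⊆ 𝔄_Λ`). [cite: ArakiMoriya2003, §4.1 Def. 4.1 (2)] -/
theorem expect_nAt_eq_expect_nAt_singleton (ω : InfVolFermionState d) {Λ : Finset (Site d)} {x : Site d}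
    (hx : x ∈ Λ) (σ : Fin 2) :
    ω.expect Λ (nAt x hx σ) = ω.expect {x} (nAt x (Finset.mem_singleton_self x) σ) := by
  have hΓ : fermionEmbed (PolySite.incl (Finset.singleton_subset_iff.2 hx))
      (nAt x (Finset.mem_singleton_self x) σ) = nAt x hx σ := by
    rw [nAt, fermionEmbed_numberOp, PolySite.incl_pt]
  rw [← hΓ, ω.compatible]

/-- **The `x`-moment of the single-site generator is the one-site density**: for a translation-invariant
state `ω` on `ℤ²`, `ω_{Λ'}(c̃†c̃) = ω_{{0}}(n_{0σ})`, `c̃ = Γ_{Λ⊆Λ'}c_{xσ}`. [cite: ArakiMoriya2003, §4.1 Def. 4.5] -/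
theorem IsTranslationInvariant.expect_conjTranspose_mul_fermionEmbed_incl_cAt {ω : InfVolFermionState 2}
    (hω : ω.IsTranslationInvariant) {Λ Λ' : Finset (Site 2)} (h : Λ ⊆ Λ') {x : Site 2} (hx : x ∈ Λ)
    (σ : Fin 2) :
    ω.expect Λ' ((fermionEmbed (PolySite.incl h) (annihilation (orb (PolySite.pt x hx) σ)))ᴴ *
        fermionEmbed (PolySite.incl h) (annihilation (orb (PolySite.pt x hx) σ))) =
      ω.expect {0} (nAt 0 (Finset.mem_singleton_self 0) σ) := by
  rw [conjTranspose_mul_fermionEmbed_incl_cAt, ω.compatible, ω.expect_nAt_eq_expect_nAt_singleton hx,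
    hω.expect_nAt x σ]

/-- **The `y'`-moment is the one-site hole density**: `ω_{Λ'}(c̃c̃†) = 1 − ω_{{0}}(n_{0σ})` for
translation-invariant `ω`. [cite: ArakiMoriya2003, §4.1 Def. 4.5] -/
theorem IsTranslationInvariant.expect_fermionEmbed_incl_cAt_mul_conjTranspose {ω : InfVolFermionState 2}
    (hω : ω.IsTranslationInvariant) {Λ Λ' : Finset (Site 2)} (h : Λ ⊆ Λ') {x : Site 2} (hx : x ∈ Λ)
    (σ : Fin 2) :
    ω.expect Λ' (fermionEmbed (PolySite.incl h) (annihilation (orb (PolySite.pt x hx) σ)) *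
        (fermionEmbed (PolySite.incl h) (annihilation (orb (PolySite.pt x hx) σ)))ᴴ) =
      1 - ω.expect {0} (nAt 0 (Finset.mem_singleton_self 0) σ) := by
  rw [fermionEmbed_incl_cAt_mul_conjTranspose, map_sub, ω.expect_one, ω.compatible,
    ω.expect_nAt_eq_expect_nAt_singleton hx, hω.expect_nAt x σ]

/-- **Spin densities of the thermal object of record**: every torus limit `ω` of the canonical Gibbs
states on `(rectN n L, S^z = 0)` along `Ls → ∞` (`0 ≤ n ≤ 2`, any `β`) has `Re ω(n_{0σ}) = n/2` for both
spins. [cite: Ruelle1969, §3.4] [cite: LiebPRL1989, eq. (2)] -/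
theorem IsTorusLimitOfMixture.re_expect_nAt_eq_half_of_sectorGibbs (t t' U β : ℝ) {n : ℝ} (hn0 : 0 ≤ n)
    (hn2 : n ≤ 2) {Ls : ℕ → ℕ} (hLs : Tendsto Ls atTop atTop) {ω : InfVolFermionState 2}
    (hω : ω.IsTorusLimitOfMixture (sectorGibbsCount n) (fun L => sectorGibbsWeightTT' β t t' U n L)
      (fun L => sectorGibbsVectorTT' t t' U n L) Ls) (σ : Fin 2) :
    (ω.expect {0} (nAt 0 (Finset.mem_singleton_self 0) σ)).re = n / 2 := by
  have hρ : Tendsto (fun j => ((rectN n (Ls j) : ℝ) / 2 + (if σ = 0 then (0 : ℝ) else -(0 : ℝ))) /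
      (Ls j : ℝ) ^ 2) atTop (𝓝 (n / 2)) := by
    refine (tendsto_halfRectN_div_sq_comp hn0 hLs).congr fun j => ?_
    rw [show rectN n (Ls j) = 2 * halfRectN n (Ls j) from rfl]
    split_ifs <;> push_cast <;> ring
  rw [hω.expect_nAt_eq_of_szSector' hLs (N := fun L => rectN n L) (M := fun _ => 0)
    (fun L i => sectorGibbsVectorTT'_mem_szSector t t' U n L i)
    (fun L i => star_sectorGibbsVectorTT'_dotProduct_self t t' U n L i)
    (Eventually.of_forall fun j => sum_sectorGibbsWeightTT' β t t' U hn0 hn2 (Ls j)) σ hρ,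
    Complex.ofReal_re]

/-- **Up-spin density of the companion `(k_L − 1, k_L)`**: a torus limit along `Ls → ∞` of the canonical
eigen-mixtures of the spin sectors `(halfRectN n L − 1, halfRectN n L)` (`0 ≤ n ≤ 2`) has
`Re ω'(n_{0↑}) = n/2`. [cite: Ruelle1969, §3.4] [cite: LiebPRL1989, eq. (2)] -/
theorem IsTorusLimitOfMixture.re_expect_nAt_up_eq_half_of_predCompanion (t t' U β : ℝ) {n : ℝ}
    (hn0 : 0 ≤ n) (hn2 : n ≤ 2) {Ls : ℕ → ℕ} (hLs : Tendsto Ls atTop atTop) {ω' : InfVolFermionState 2}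
    (hω' : ω'.IsTorusLimitOfMixture
      (fun L => Fintype.card (Subtype (spinConfig (Λ := FermionTorus 2 L) (halfRectN n L - 1) (halfRectN n L))))
      (fun L i => canonicalWeight β (sectorEigenvalue (spinConfig (halfRectN n L - 1) (halfRectN n L))
        (hubbardTorusTT' L t t' U) (hubbardTorusTT'_isHermitian L t t' U)) ((Fintype.equivFin _).symm i))
      (fun L i => sectorEigenvector (spinConfig (halfRectN n L - 1) (halfRectN n L)) (hubbardTorusTT' L t t' U)
        (hubbardTorusTT'_isHermitian L t t' U) ((Fintype.equivFin _).symm i)) Ls) :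
    (ω'.expect {0} (nAt 0 (Finset.mem_singleton_self 0) 0)).re = n / 2 :=
  (hω'.re_expect_nAt_eq_of_spinSectorGibbs t t' U β (fun L => halfRectN n L - 1) (fun L => halfRectN n L)
    (fun _ => (Fintype.equivFin _).symm) (fun _ _ => rfl) (fun _ _ => rfl) hLs
    (Eventually.of_forall fun j =>
      ⟨(Nat.sub_le _ _).trans (halfRectN_le_mul_self hn0 hn2 (Ls j)), halfRectN_le_mul_self hn0 hn2 (Ls j)⟩)).1
    (tendsto_halfRectN_pred_div_sq_comp hn0 hLs)

end InfVolFermionState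

end Densities

/-! ### §3 The REVERSED row: the raising generator `c†_{x↑}` from the companion sector `(k − 1, k)` back to
`(k, k)`, with the inverted ratio -/

section Reverse

variable (t t' U β : ℝ)

/-- The weights of record are the canonical weights of the sector `szConfig n L`, reindexed by
`sectorGibbsIndex`. [cite: Israel1979, §I.3 eq. (26)] -/
theorem sectorGibbsWeightTT'_eq_canonicalWeight (n : ℝ) (L : ℕ) (i : Fin (sectorGibbsCount n L)) :
    sectorGibbsWeightTT' β t t' U n L i =
      canonicalWeight β (sectorEigenvalue (szConfig n L) (hubbardTorusTT' L t t' U)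
        (hubbardTorusTT'_isHermitian L t t' U)) (sectorGibbsIndex n L i) := by
  rw [sectorGibbsWeightTT', show sectorGibbsEnergyTT' t t' U n L =
    sectorEigenvalue (szConfig n L) (hubbardTorusTT' L t t' U) (hubbardTorusTT'_isHermitian L t t' U) ∘
      sectorGibbsIndex n L from rfl]
  unfold canonicalWeight
  rw [show (∑ b, Real.exp (-(β * (sectorEigenvalue (szConfig n L) (hubbardTorusTT' L t t' U)
      (hubbardTorusTT'_isHermitian L t t' U) ∘ sectorGibbsIndex n L) b))) =
    ∑ b, Real.exp (-(β * sectorEigenvalue (szConfig n L) (hubbardTorusTT' L t t' U)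
      (hubbardTorusTT'_isHermitian L t t' U) b)) from
    Equiv.sum_comp (sectorGibbsIndex n L) (fun b => Real.exp (-(β * sectorEigenvalue (szConfig n L)
      (hubbardTorusTT' L t t' U) (hubbardTorusTT'_isHermitian L t t' U) b)))]
  rfl

/-- **The reversed two-sector row of the pair `(ω, ω')`: the raising generator `c†_{x↑}` read from the
companion.** Let `ω` be a torus limit of the canonical Gibbs states on `(rectN n L, S^z = 0)` along
`Ls → ∞` (`0 < n`), `ω'` a torus limit ALONG THE SAME `Ls` of the canonical states on the spin sectors
`(k_L − 1, k_L)`, and `r' = lim_j Z_{(k,k)}(Ls j)/Z_{(k−1,k)}(Ls j)` (the INVERSE of the ratio of the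
«rm↑» row). Then for `x ∈ Λ`, `ã† = Γ_{Λ⊆Λ₁}c†_{x↑}`, `Λ₁ = thicken Λ 1`, and all real `s, q` with
`e^{s−1} ≤ q`:
`0 ≤ β·Re ω'_{Λ₁}(ã(H^{tt'U}_{Λ₁}ã† − ã†H^{tt'U}_{Λ₁})) − s·Re ω'_{Λ₁}(ãã†) + q·r'·Re ω_{Λ₁}(ã†ã)` — the row
that links the companion's moments BACK to the object of record with the same (inverted) parameter.
[cite: FawziFawziScalet2024, Thm. 3.1] [cite: BratteliRobinsonII1997, §5.4.2]
[cite: LiebPRL1989, proof of Theorem 1] -/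
theorem InfVolFermionState.IsTorusLimitOfMixture.re_expect_twoSector_eeb_creation_up_reverse_nonneg_of_sectorGibbs
    {n : ℝ} (hn : 0 < n) {Ls : ℕ → ℕ} (hLs : Tendsto Ls atTop atTop) {ω ω' : InfVolFermionState 2}
    (hω : ω.IsTorusLimitOfMixture (sectorGibbsCount n) (fun L => sectorGibbsWeightTT' β t t' U n L)
      (fun L => sectorGibbsVectorTT' t t' U n L) Ls)
    (hω' : ω'.IsTorusLimitOfMixture
      (fun L => Fintype.card (Subtype (spinConfig (Λ := FermionTorus 2 L) (halfRectN n L - 1) (halfRectN n L))))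
      (fun L i => canonicalWeight β (sectorEigenvalue (spinConfig (halfRectN n L - 1) (halfRectN n L))
        (hubbardTorusTT' L t t' U) (hubbardTorusTT'_isHermitian L t t' U)) ((Fintype.equivFin _).symm i))
      (fun L i => sectorEigenvector (spinConfig (halfRectN n L - 1) (halfRectN n L)) (hubbardTorusTT' L t t' U)
        (hubbardTorusTT'_isHermitian L t t' U) ((Fintype.equivFin _).symm i)) Ls)
    {r' : ℝ} (hr' : Tendsto (fun j =>
      (∑ c, Real.exp (-(β * sectorEigenvalue (szConfig n (Ls j)) (hubbardTorusTT' (Ls j) t t' U)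
          (hubbardTorusTT'_isHermitian (Ls j) t t' U) c))) /
        ∑ d, Real.exp (-(β * sectorEigenvalue (spinConfig (halfRectN n (Ls j) - 1) (halfRectN n (Ls j)))
          (hubbardTorusTT' (Ls j) t t' U) (hubbardTorusTT'_isHermitian (Ls j) t t' U) d))) atTop (𝓝 r'))
    {Λ : Finset (Site 2)} {x : Site 2} (hx : x ∈ Λ) {s q : ℝ} (hq : Real.exp (s - 1) ≤ q) :
    0 ≤ β * (ω'.expect (thicken Λ 1)
          ((fermionEmbed (PolySite.incl (subset_thicken Λ 1)) (creation (orb (PolySite.pt x hx) 0)))ᴴ *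
            ((hubbardTTPrimeFermionInteraction t t' U).localHamiltonian (thicken Λ 1) *
                fermionEmbed (PolySite.incl (subset_thicken Λ 1)) (creation (orb (PolySite.pt x hx) 0)) -
              fermionEmbed (PolySite.incl (subset_thicken Λ 1)) (creation (orb (PolySite.pt x hx) 0)) *
                (hubbardTTPrimeFermionInteraction t t' U).localHamiltonian (thicken Λ 1)))).re -
        s * (ω'.expect (thicken Λ 1)
          ((fermionEmbed (PolySite.incl (subset_thicken Λ 1)) (creation (orb (PolySite.pt x hx) 0)))ᴴ *
            fermionEmbed (PolySite.incl (subset_thicken Λ 1)) (creation (orb (PolySite.pt x hx) 0)))).re +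
        q * r' * (ω.expect (thicken Λ 1)
          (fermionEmbed (PolySite.incl (subset_thicken Λ 1)) (creation (orb (PolySite.pt x hx) 0)) *
            (fermionEmbed (PolySite.incl (subset_thicken Λ 1)) (creation (orb (PolySite.pt x hx) 0)))ᴴ)).re := by
  refine InfVolFermionState.re_expect_twoSector_eeb_nonneg_of_canonical_limits_eventually t t' U β
    (fun L => spinConfig (Λ := FermionTorus 2 L) (halfRectN n L - 1) (halfRectN n L)) (fun L => szConfig n L)
    (fun L s s' hs hs' => hubbardTorusTT'_apply_eq_zero_of_spinConfig L t t' U _ _ s s' hs hs')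
    (fun L s s' hs hs' => hubbardTorusTT'_apply_eq_zero_of_szConfig L t t' U n s s' hs hs')
    (fun L _ v s s' hs hs' => fockTranslate_apply_eq_zero_of_spinConfig L v _ _ s s' hs hs')
    (fun L _ v s s' hs hs' => fockTranslate_apply_eq_zero_of_szConfig L v n s s' hs hs')
    (fun L => (Fintype.equivFin _).symm) (fun L => sectorGibbsIndex n L)
    (fun L i => rfl) (fun L i => rfl) (sectorGibbsWeightTT'_eq_canonicalWeight t t' U β n) (fun L i => rfl)
    hLs hω' hω hr' (creation (orb (PolySite.pt x hx) 0)) ?_ ?_ hq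
  · filter_upwards [eventually_one_le_halfRectN_comp hn hLs] with j hk hL h₁ s s' hs hs'
    rw [fermionEmbed_toTorusEmb_incl_creation, ← annihilation_conjTranspose]
    exact apply_eq_zero_off_of_mulVec_mem₂ (spinConfig _ _) (szConfig n (Ls j))
      (szSector _ _) (szSector (rectN n (Ls j)) 0) (mem_szSector_iff_spinConfig (Ls j) _ _)
      (mem_szSector_rectN_iff n (Ls j))
      (fun w hw => creation_up_mulVec_mem_szSector_rectN (Ls j) hk _ w hw) s s' hs hs'
  · filter_upwards [eventually_one_le_halfRectN_comp hn hLs] with j hk hL h₁ s s' hs hs'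
    rw [fermionEmbed_toTorusEmb_incl_creation, creation_conjTranspose]
    exact apply_eq_zero_off_of_mulVec_mem₂ (szConfig n (Ls j)) (spinConfig _ _)
      (szSector (rectN n (Ls j)) 0) (szSector _ _) (mem_szSector_rectN_iff n (Ls j))
      (mem_szSector_iff_spinConfig (Ls j) _ _)
      (fun w hw => annihilation_up_mulVec_mem_szSector_pred (Ls j) hk _ w hw) s s' hs hs'

end Reverse

end Literature.MathematicalPhysics.QuantumLattice

end
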